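import Mathlib
import HarnessLib.Audit
import Summits.PneNP.PneNP.Theorems.PstarChordReadSwitch

/-!
# Coupled switches `(zᵢ, zⱼ)`: the uniform-type kills with a togglable partner (ROUND-24, O1 at exact tightness; memo g20 §13.10, residual R3)

FRONTIER range-avoidance ladder, rung F-N3, ROUND 24 (cell `pnp-ideate`, prover-2 memo `g20/O1-CHORD-READ-g20.md` §13.10 (residual R3: the partners
`zᵢ, zⱼ` of two private gates are COUPLED by a monomial `(zᵢ, zⱼ)`); typed target `PstarCoreBoundTargets.TerminalPeelable` (p646951); restricted-model
proof complexity — nothing here bears on `P` versus `NP`).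

With a coupling monomial the move of `zᵢ` is `e ⊕ λ x_{pᵢ} ⊕ ν x_{zⱼ}` — it depends on the OUTSIDE variable `zⱼ`, which can be toggled at any
solution.  Memo §13.10: RANK ONE never fires on a coupled pair (a quadratic map `𝔽₂² → 𝔽₂²` with a product term is never onto), and (T3) on the
four flips forces either a UNIFORM type `ν` or a pinned base pair.  This file kills the uniform branch in SEMANTIC form, generalising
`PstarChordReadSwitch.false_of_typeI/III`: the switch need not be live on a fixed slice — it suffices that at every solution on `{x_q = 0}` it is
live either at the point or after toggling a partner variable `u` that is itself outside the core and invisible to the reader in question.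

* `fail₂_of_togglable` — free lunch with a togglable partner: `Γ₂` fails on the whole slice `{x_q = 0}`;
* `false_of_coupled_typeI` / `false_of_coupled_typeII` — two distinct non-parallel chords with such switches ⟹ `Γ₂` (resp. `Γ₁`) chord-local
  at both ⟹ constant ⟹ dead;
* `false_of_coupled_typeIII` — the same for switches moving both readers, with the partner invisible to the SUM reader.

No Assumption A.  The non-uniform branch (pinned base pair on a double-slice pattern) needs double-slice genericity (certificate engine
`dslice2.py`, kit j318054) and is not treated here.
-/

set_option linter.dupNamespace false -- `Summit.PneNP.PneNP.…`: summit = sub-problem name (D-0017 single-conjunct layout)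

open Finset Literature.Computability.Complexity
open scoped symmDiff
open Summit.PneNP.PneNP.Theorems.PstarTyped (Typed)
open Summit.PneNP.PneNP.Theorems.PstarSALevel (varSet bdry BoundaryExpanding SimpleOverlap)
open Summit.PneNP.PneNP.Theorems.PstarGapOneAll (gval)
open Summit.PneNP.PneNP.Theorems.PstarGConstraint (gval_update_of_forall_ne)
open Summit.PneNP.PneNP.Theorems.PstarChordRepair (IsChord)
open Summit.PneNP.PneNP.Theorems.PstarCoreBoundTargets (Terminal)
open Summit.PneNP.PneNP.Theorems.PstarGSystemFreeVar (gval_symmDiff)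
open Summit.PneNP.PneNP.Theorems.PstarFreshEraseGates (terminal_symm)
open Summit.PneNP.PneNP.Theorems.PstarChordReadLemma (ChordLocal SliceGeneric chordLocal_of_fail_slice)
open Summit.PneNP.PneNP.Theorems.PstarChordReadSwitch

namespace Summit.PneNP.PneNP.Theorems.PstarChordReadCoupled

variable {n m : ℕ}

/-- `G₁ ∆ G₂ ⊆ G₁ ∪ G₂`. -/
private theorem symmDiff_subset_union' (G₁ G₂ : Finset (Fin m)) : G₁ ∆ G₂ ⊆ G₁ ∪ G₂ := fun g hg => by
  rcases Finset.mem_symmDiff.1 hg with ⟨h, -⟩ | ⟨h, -⟩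
  · exact mem_union_left _ h
  · exact mem_union_right _ h

section Main

variable {I : LocalMap 4 n m} {r : ℕ} {y : Fin m → Bool} {J₀ : Finset (Fin m)} {w₁ w₂ : Finset (Fin n) × Finset (Fin m) × Bool}

/-- **Free lunch with a togglable partner.**  `z` and `u` outside the core and invisible to `Γ₂`; at every solution with `x_q = 0` flipping `z`
moves `Γ₁` either at the point or at its `u`-toggle: then `Γ₂` fails at every solution with `x_q = 0`. -/
theorem fail₂_of_togglable (ht : Terminal I r y J₀ w₁ w₂) {c : Fin m} {z u : Fin n} (hz : ∀ j ∈ J₀, z ∉ varSet I j) (hzC : z ∉ w₂.1)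
    (hzG : ∀ g ∈ w₂.2.1, I.vars g 2 ≠ z ∧ I.vars g 3 ≠ z) (hu : ∀ j ∈ J₀, u ∉ varSet I j) (huC : u ∉ w₂.1)
    (huG : ∀ g ∈ w₂.2.1, I.vars g 2 ≠ u ∧ I.vars g 3 ≠ u)
    (hmove : ∀ x : Fin n → Bool, (∀ j ∈ J₀, I.eval x j = y j) → x (I.vars c 3) = false →
      gval I w₁.1 w₁.2.1 (Function.update x z (!x z)) ≠ gval I w₁.1 w₁.2.1 x ∨
      gval I w₁.1 w₁.2.1 (Function.update (Function.update x u (!x u)) z (!(Function.update x u (!x u)) z)) ≠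
        gval I w₁.1 w₁.2.1 (Function.update x u (!x u))) :
    ∀ x : Fin n → Bool, (∀ j ∈ J₀, I.eval x j = y j) → x (I.vars c 3) = false → gval I w₂.1 w₂.2.1 x ≠ w₂.2.2 := by
  intro x hx hq
  rcases hmove x hx hq with h | h
  · exact gval₂_ne_of_switch₁ ht hz hzC hzG hx h
  · have hx' := solves_update_of_outside hu hx (!x u)
    have h₂ := gval₂_ne_of_switch₁ ht hz hzC hzG hx' h
    rwa [gval_update_of_forall_ne I x huC huG] at h₂

/-- From failure on the whole slice `{x_q = 0}` to chord-locality. -/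
private theorem chordLocal_of_fail_q (hI : I.IsPure xorAndPred) {c : Fin m} (hc : c ∈ J₀) (hch : IsChord I J₀ c) {𝒢 : Finset (Fin m)}
    (hgen : SliceGeneric I y J₀ c 𝒢)
    (hmono : ∀ g ∈ 𝒢, (I.vars g 2 ≠ I.vars c 2 ∧ I.vars g 3 ≠ I.vars c 2) ∧ (I.vars g 2 ≠ I.vars c 3 ∧ I.vars g 3 ≠ I.vars c 3))
    {C : Finset (Fin n)} {G : Finset (Fin m)} (hG : G ⊆ 𝒢) {b : Bool}
    (hfail : ∀ x : Fin n → Bool, (∀ j ∈ J₀, I.eval x j = y j) → x (I.vars c 3) = false → gval I C G x ≠ b) : ChordLocal I c C G :=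
  chordLocal_of_fail_slice hI hc hch hgen hmono hG false false b fun x hx _ hq => hfail x hx hq

/-- **COUPLED TYPE I KILL.**  Two distinct non-parallel chords, slice-generic for the menu of `Γ₂` (whose monomials avoid their privates), each with
an outside switch `zᵢ` (resp. `zⱼ`) invisible to `Γ₂` and a togglable outside partner `uᵢ` (resp. `uⱼ`) invisible to `Γ₂`, live in the sense of
`fail₂_of_togglable`: then `Γ₂` is chord-local at both chords, hence constant — impossible. -/
theorem false_of_coupled_typeI (hI : I.IsPure xorAndPred) (hT : Typed I) (hS : SimpleOverlap I) (hB : BoundaryExpanding r I)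
    (ht : Terminal I r y J₀ w₁ w₂) {cᵢ cⱼ : Fin m} (hcᵢ : cᵢ ∈ J₀) (hcⱼ : cⱼ ∈ J₀) (hne : cᵢ ≠ cⱼ) (hchᵢ : IsChord I J₀ cᵢ)
    (hchⱼ : IsChord I J₀ cⱼ) (hv : ∃ s : Fin 4, s.val < 2 ∧ I.vars cᵢ s ∉ varSet I cⱼ)
    (hmonoᵢ : ∀ g ∈ w₂.2.1, (I.vars g 2 ≠ I.vars cᵢ 2 ∧ I.vars g 3 ≠ I.vars cᵢ 2) ∧ (I.vars g 2 ≠ I.vars cᵢ 3 ∧ I.vars g 3 ≠ I.vars cᵢ 3))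
    (hmonoⱼ : ∀ g ∈ w₂.2.1, (I.vars g 2 ≠ I.vars cⱼ 2 ∧ I.vars g 3 ≠ I.vars cⱼ 2) ∧ (I.vars g 2 ≠ I.vars cⱼ 3 ∧ I.vars g 3 ≠ I.vars cⱼ 3))
    (hgenᵢ : SliceGeneric I y J₀ cᵢ w₂.2.1) (hgenⱼ : SliceGeneric I y J₀ cⱼ w₂.2.1) {zᵢ uᵢ zⱼ uⱼ : Fin n}
    (hzᵢ : ∀ j ∈ J₀, zᵢ ∉ varSet I j) (hzᵢC : zᵢ ∉ w₂.1) (hzᵢG : ∀ g ∈ w₂.2.1, I.vars g 2 ≠ zᵢ ∧ I.vars g 3 ≠ zᵢ)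
    (huᵢ : ∀ j ∈ J₀, uᵢ ∉ varSet I j) (huᵢC : uᵢ ∉ w₂.1) (huᵢG : ∀ g ∈ w₂.2.1, I.vars g 2 ≠ uᵢ ∧ I.vars g 3 ≠ uᵢ)
    (hzⱼ : ∀ j ∈ J₀, zⱼ ∉ varSet I j) (hzⱼC : zⱼ ∉ w₂.1) (hzⱼG : ∀ g ∈ w₂.2.1, I.vars g 2 ≠ zⱼ ∧ I.vars g 3 ≠ zⱼ)
    (huⱼ : ∀ j ∈ J₀, uⱼ ∉ varSet I j) (huⱼC : uⱼ ∉ w₂.1) (huⱼG : ∀ g ∈ w₂.2.1, I.vars g 2 ≠ uⱼ ∧ I.vars g 3 ≠ uⱼ)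
    (hmoveᵢ : ∀ x : Fin n → Bool, (∀ j ∈ J₀, I.eval x j = y j) → x (I.vars cᵢ 3) = false →
      gval I w₁.1 w₁.2.1 (Function.update x zᵢ (!x zᵢ)) ≠ gval I w₁.1 w₁.2.1 x ∨
      gval I w₁.1 w₁.2.1 (Function.update (Function.update x uᵢ (!x uᵢ)) zᵢ (!(Function.update x uᵢ (!x uᵢ)) zᵢ)) ≠
        gval I w₁.1 w₁.2.1 (Function.update x uᵢ (!x uᵢ)))
    (hmoveⱼ : ∀ x : Fin n → Bool, (∀ j ∈ J₀, I.eval x j = y j) → x (I.vars cⱼ 3) = false →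
      gval I w₁.1 w₁.2.1 (Function.update x zⱼ (!x zⱼ)) ≠ gval I w₁.1 w₁.2.1 x ∨
      gval I w₁.1 w₁.2.1 (Function.update (Function.update x uⱼ (!x uⱼ)) zⱼ (!(Function.update x uⱼ (!x uⱼ)) zⱼ)) ≠
        gval I w₁.1 w₁.2.1 (Function.update x uⱼ (!x uⱼ))) : False := by
  have hᵢ := chordLocal_of_fail_q hI hcᵢ hchᵢ hgenᵢ hmonoᵢ (Subset.refl _) (fail₂_of_togglable ht hzᵢ hzᵢC hzᵢG huᵢ huᵢC huᵢG hmoveᵢ)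
  have hⱼ := chordLocal_of_fail_q hI hcⱼ hchⱼ hgenⱼ hmonoⱼ (Subset.refl _) (fail₂_of_togglable ht hzⱼ hzⱼC hzⱼG huⱼ huⱼC huⱼG hmoveⱼ)
  refine false_of_gval₂_const hI hT hS hB ht fun x x' => ?_
  rw [gval_eq_false_of_two_chordLocal hI hcᵢ hcⱼ hne hchᵢ hv hᵢ hⱼ x, gval_eq_false_of_two_chordLocal hI hcᵢ hcⱼ hne hchᵢ hv hᵢ hⱼ x']

/-- **COUPLED TYPE II KILL** (readers exchanged). -/
theorem false_of_coupled_typeII (hI : I.IsPure xorAndPred) (hT : Typed I) (hS : SimpleOverlap I) (hB : BoundaryExpanding r I)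
    (ht : Terminal I r y J₀ w₁ w₂) {cᵢ cⱼ : Fin m} (hcᵢ : cᵢ ∈ J₀) (hcⱼ : cⱼ ∈ J₀) (hne : cᵢ ≠ cⱼ) (hchᵢ : IsChord I J₀ cᵢ)
    (hchⱼ : IsChord I J₀ cⱼ) (hv : ∃ s : Fin 4, s.val < 2 ∧ I.vars cᵢ s ∉ varSet I cⱼ)
    (hmonoᵢ : ∀ g ∈ w₁.2.1, (I.vars g 2 ≠ I.vars cᵢ 2 ∧ I.vars g 3 ≠ I.vars cᵢ 2) ∧ (I.vars g 2 ≠ I.vars cᵢ 3 ∧ I.vars g 3 ≠ I.vars cᵢ 3))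
    (hmonoⱼ : ∀ g ∈ w₁.2.1, (I.vars g 2 ≠ I.vars cⱼ 2 ∧ I.vars g 3 ≠ I.vars cⱼ 2) ∧ (I.vars g 2 ≠ I.vars cⱼ 3 ∧ I.vars g 3 ≠ I.vars cⱼ 3))
    (hgenᵢ : SliceGeneric I y J₀ cᵢ w₁.2.1) (hgenⱼ : SliceGeneric I y J₀ cⱼ w₁.2.1) {zᵢ uᵢ zⱼ uⱼ : Fin n}
    (hzᵢ : ∀ j ∈ J₀, zᵢ ∉ varSet I j) (hzᵢC : zᵢ ∉ w₁.1) (hzᵢG : ∀ g ∈ w₁.2.1, I.vars g 2 ≠ zᵢ ∧ I.vars g 3 ≠ zᵢ)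
    (huᵢ : ∀ j ∈ J₀, uᵢ ∉ varSet I j) (huᵢC : uᵢ ∉ w₁.1) (huᵢG : ∀ g ∈ w₁.2.1, I.vars g 2 ≠ uᵢ ∧ I.vars g 3 ≠ uᵢ)
    (hzⱼ : ∀ j ∈ J₀, zⱼ ∉ varSet I j) (hzⱼC : zⱼ ∉ w₁.1) (hzⱼG : ∀ g ∈ w₁.2.1, I.vars g 2 ≠ zⱼ ∧ I.vars g 3 ≠ zⱼ)
    (huⱼ : ∀ j ∈ J₀, uⱼ ∉ varSet I j) (huⱼC : uⱼ ∉ w₁.1) (huⱼG : ∀ g ∈ w₁.2.1, I.vars g 2 ≠ uⱼ ∧ I.vars g 3 ≠ uⱼ)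
    (hmoveᵢ : ∀ x : Fin n → Bool, (∀ j ∈ J₀, I.eval x j = y j) → x (I.vars cᵢ 3) = false →
      gval I w₂.1 w₂.2.1 (Function.update x zᵢ (!x zᵢ)) ≠ gval I w₂.1 w₂.2.1 x ∨
      gval I w₂.1 w₂.2.1 (Function.update (Function.update x uᵢ (!x uᵢ)) zᵢ (!(Function.update x uᵢ (!x uᵢ)) zᵢ)) ≠
        gval I w₂.1 w₂.2.1 (Function.update x uᵢ (!x uᵢ)))
    (hmoveⱼ : ∀ x : Fin n → Bool, (∀ j ∈ J₀, I.eval x j = y j) → x (I.vars cⱼ 3) = false →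
      gval I w₂.1 w₂.2.1 (Function.update x zⱼ (!x zⱼ)) ≠ gval I w₂.1 w₂.2.1 x ∨
      gval I w₂.1 w₂.2.1 (Function.update (Function.update x uⱼ (!x uⱼ)) zⱼ (!(Function.update x uⱼ (!x uⱼ)) zⱼ)) ≠
        gval I w₂.1 w₂.2.1 (Function.update x uⱼ (!x uⱼ))) : False :=
  false_of_coupled_typeI hI hT hS hB (terminal_symm ht) hcᵢ hcⱼ hne hchᵢ hchⱼ hv hmonoᵢ hmonoⱼ hgenᵢ hgenⱼ hzᵢ hzᵢC hzᵢG huᵢ huᵢC huᵢG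
    hzⱼ hzⱼC hzⱼG huⱼ huⱼC huⱼG hmoveᵢ hmoveⱼ

/-- **COUPLED TYPE III KILL.**  Switches moving BOTH readers (at the point or at the toggle of a partner `u` invisible to the SUM reader — e.g. a
partner all of whose monomials lie in both readers): the sum reader fails on the slices `{x_{qᵢ} = 0}`, `{x_{qⱼ} = 0}`, is chord-local at both
chords, hence identically `false`, i.e. `Γ₁ = Γ₂` — impossible. -/
theorem false_of_coupled_typeIII (hI : I.IsPure xorAndPred) (hT : Typed I) (hS : SimpleOverlap I) (hB : BoundaryExpanding r I)
    (ht : Terminal I r y J₀ w₁ w₂) {cᵢ cⱼ : Fin m} (hcᵢ : cᵢ ∈ J₀) (hcⱼ : cⱼ ∈ J₀) (hne : cᵢ ≠ cⱼ) (hchᵢ : IsChord I J₀ cᵢ)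
    (hchⱼ : IsChord I J₀ cⱼ) (hv : ∃ s : Fin 4, s.val < 2 ∧ I.vars cᵢ s ∉ varSet I cⱼ)
    (hmonoᵢ : ∀ g ∈ w₁.2.1 ∆ w₂.2.1, (I.vars g 2 ≠ I.vars cᵢ 2 ∧ I.vars g 3 ≠ I.vars cᵢ 2) ∧ (I.vars g 2 ≠ I.vars cᵢ 3 ∧ I.vars g 3 ≠ I.vars cᵢ 3))
    (hmonoⱼ : ∀ g ∈ w₁.2.1 ∆ w₂.2.1, (I.vars g 2 ≠ I.vars cⱼ 2 ∧ I.vars g 3 ≠ I.vars cⱼ 2) ∧ (I.vars g 2 ≠ I.vars cⱼ 3 ∧ I.vars g 3 ≠ I.vars cⱼ 3))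
    (hgenᵢ : SliceGeneric I y J₀ cᵢ (w₁.2.1 ∆ w₂.2.1)) (hgenⱼ : SliceGeneric I y J₀ cⱼ (w₁.2.1 ∆ w₂.2.1)) {zᵢ uᵢ zⱼ uⱼ : Fin n}
    (hzᵢ : ∀ j ∈ J₀, zᵢ ∉ varSet I j) (hzⱼ : ∀ j ∈ J₀, zⱼ ∉ varSet I j)
    (huᵢ : ∀ j ∈ J₀, uᵢ ∉ varSet I j) (huᵢC : uᵢ ∉ w₁.1 ∆ w₂.1) (huᵢG : ∀ g ∈ w₁.2.1 ∆ w₂.2.1, I.vars g 2 ≠ uᵢ ∧ I.vars g 3 ≠ uᵢ)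
    (huⱼ : ∀ j ∈ J₀, uⱼ ∉ varSet I j) (huⱼC : uⱼ ∉ w₁.1 ∆ w₂.1) (huⱼG : ∀ g ∈ w₁.2.1 ∆ w₂.2.1, I.vars g 2 ≠ uⱼ ∧ I.vars g 3 ≠ uⱼ)
    (hmoveᵢ : ∀ x : Fin n → Bool, (∀ j ∈ J₀, I.eval x j = y j) → x (I.vars cᵢ 3) = false →
      (gval I w₁.1 w₁.2.1 (Function.update x zᵢ (!x zᵢ)) ≠ gval I w₁.1 w₁.2.1 x ∧
        gval I w₂.1 w₂.2.1 (Function.update x zᵢ (!x zᵢ)) ≠ gval I w₂.1 w₂.2.1 x) ∨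
      (gval I w₁.1 w₁.2.1 (Function.update (Function.update x uᵢ (!x uᵢ)) zᵢ (!(Function.update x uᵢ (!x uᵢ)) zᵢ)) ≠
          gval I w₁.1 w₁.2.1 (Function.update x uᵢ (!x uᵢ)) ∧
        gval I w₂.1 w₂.2.1 (Function.update (Function.update x uᵢ (!x uᵢ)) zᵢ (!(Function.update x uᵢ (!x uᵢ)) zᵢ)) ≠
          gval I w₂.1 w₂.2.1 (Function.update x uᵢ (!x uᵢ))))
    (hmoveⱼ : ∀ x : Fin n → Bool, (∀ j ∈ J₀, I.eval x j = y j) → x (I.vars cⱼ 3) = false →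
      (gval I w₁.1 w₁.2.1 (Function.update x zⱼ (!x zⱼ)) ≠ gval I w₁.1 w₁.2.1 x ∧
        gval I w₂.1 w₂.2.1 (Function.update x zⱼ (!x zⱼ)) ≠ gval I w₂.1 w₂.2.1 x) ∨
      (gval I w₁.1 w₁.2.1 (Function.update (Function.update x uⱼ (!x uⱼ)) zⱼ (!(Function.update x uⱼ (!x uⱼ)) zⱼ)) ≠
          gval I w₁.1 w₁.2.1 (Function.update x uⱼ (!x uⱼ)) ∧
        gval I w₂.1 w₂.2.1 (Function.update (Function.update x uⱼ (!x uⱼ)) zⱼ (!(Function.update x uⱼ (!x uⱼ)) zⱼ)) ≠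
          gval I w₂.1 w₂.2.1 (Function.update x uⱼ (!x uⱼ)))) : False := by
  classical
  -- the sum reader fails on both slices
  have hsum : ∀ {c : Fin m} {z u : Fin n}, (∀ j ∈ J₀, z ∉ varSet I j) → (∀ j ∈ J₀, u ∉ varSet I j) → u ∉ w₁.1 ∆ w₂.1 →
      (∀ g ∈ w₁.2.1 ∆ w₂.2.1, I.vars g 2 ≠ u ∧ I.vars g 3 ≠ u) →
      (∀ x : Fin n → Bool, (∀ j ∈ J₀, I.eval x j = y j) → x (I.vars c 3) = false →
        (gval I w₁.1 w₁.2.1 (Function.update x z (!x z)) ≠ gval I w₁.1 w₁.2.1 x ∧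
          gval I w₂.1 w₂.2.1 (Function.update x z (!x z)) ≠ gval I w₂.1 w₂.2.1 x) ∨
        (gval I w₁.1 w₁.2.1 (Function.update (Function.update x u (!x u)) z (!(Function.update x u (!x u)) z)) ≠
            gval I w₁.1 w₁.2.1 (Function.update x u (!x u)) ∧
          gval I w₂.1 w₂.2.1 (Function.update (Function.update x u (!x u)) z (!(Function.update x u (!x u)) z)) ≠
            gval I w₂.1 w₂.2.1 (Function.update x u (!x u)))) →
      ∀ x : Fin n → Bool, (∀ j ∈ J₀, I.eval x j = y j) → x (I.vars c 3) = false →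
        gval I (w₁.1 ∆ w₂.1) (w₁.2.1 ∆ w₂.2.1) x ≠ xor w₁.2.2 w₂.2.2 := by
    intro c z u hz hu huC huG hmove x hx hq h
    have key : ∀ x' : Fin n → Bool, (∀ j ∈ J₀, I.eval x' j = y j) →
        gval I w₁.1 w₁.2.1 (Function.update x' z (!x' z)) ≠ gval I w₁.1 w₁.2.1 x' →
        gval I w₂.1 w₂.2.1 (Function.update x' z (!x' z)) ≠ gval I w₂.1 w₂.2.1 x' →
        gval I (w₁.1 ∆ w₂.1) (w₁.2.1 ∆ w₂.2.1) x' ≠ xor w₁.2.2 w₂.2.2 := by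
      intro x' hx' m₁ m₂ h'
      have hb := xor_gval_of_switch_both ht hz hx' m₁ m₂
      rw [gval_symmDiff] at h'
      rw [h'] at hb
      revert hb; cases w₁.2.2 <;> cases w₂.2.2 <;> decide
    rcases hmove x hx hq with ⟨m₁, m₂⟩ | ⟨m₁, m₂⟩
    · exact key x hx m₁ m₂ h
    · have hx' := solves_update_of_outside hu hx (!x u)
      refine key _ hx' m₁ m₂ ?_
      rw [gval_update_of_forall_ne I x huC huG]; exact h
  have hᵢ := chordLocal_of_fail_q hI hcᵢ hchᵢ hgenᵢ hmonoᵢ (Subset.refl _) (hsum hzᵢ huᵢ huᵢC huᵢG hmoveᵢ)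
  have hⱼ := chordLocal_of_fail_q hI hcⱼ hchⱼ hgenⱼ hmonoⱼ (Subset.refl _) (hsum hzⱼ huⱼ huⱼC huⱼG hmoveⱼ)
  refine false_of_gval_eq hI hT hS hB ht fun x => ?_
  have h := gval_eq_false_of_two_chordLocal hI hcᵢ hcⱼ hne hchᵢ hv hᵢ hⱼ x
  rw [gval_symmDiff] at h
  revert h; cases gval I w₁.1 w₁.2.1 x <;> cases gval I w₂.1 w₂.2.1 x <;> decide

end Main

end Summit.PneNP.PneNP.Theorems.PstarChordReadCoupled
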